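import Mathlib
import Literature.NumberTheory.Automorphic.SpectralTestFunctions
import Literature.NumberTheory.Automorphic.L2EigenvalueNonneg
import Literature.NumberTheory.Automorphic.ModularPretraceFromParseval

/-!
# Theorem 7.4 and Proposition 7.2 for a general finite volume group from the spectral resolution of `L²(Γ\ℍ)`
(Iwaniec, *Spectral Methods of Automorphic Forms*, GSM 53, Thm 7.3 (7.15)–(7.16) with Thm 4.7
(4.15) ("Combining Theorems 4.7 and 7.3 one gets the spectral decomposition of the whole space
`L²(Γ\ℍ)`", p. 75), Prop. 7.2 (7.10) and its proof (7.8)–(7.9), §7.4 & Thm 7.4 (7.17); PDF pp. 71–76)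

Second of three files (after `SpectralTestFunctions.lean`) carrying out for a GENERAL finite volume
group the top layer of the proof of `Literature.NumberTheory.Automorphic.Iwaniec2002_eq_12_5`: what
`ModularPretraceFromParseval.lean` did for `SL₂(ℤ)`. Everything is PROVED; nothing is vendored; no
fact is introduced; the spectral theorem enters as the HYPOTHESIS SCHEMA `SpectralResolution Γ F`
(data, not a named fact), exactly as `SpectralDatum Γ F B` (`PretraceEstimate.lean`) records what
Chapter 12 consumes.

1. (§1) `SpectralResolution Γ F` — **the spectral resolution of `L²(Γ\ℍ)` tested on functions of
   compact support mod `Γ`**: a countable orthonormal family `(u_j)` of automorphic `C²`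
   eigenfunctions in `L²(F)`, `(Δ + λ_j)u_j = 0` (`λ_j ∈ ℝ`; in the book: the Maass cusp forms of
   Theorem 4.7 AND the residues of the Eisenstein series in `1/2 < s ≤ 1`, §7.3), only finitely many
   `λ_j < 1/4`, and eigenpackets `E_𝔞(z, r)` (`𝔞 < c`; in the book `E_𝔞(z, 1/2 + ir)` at the `c`
   inequivalent cusps, continued to the critical line, Chapter 6) — automorphic `C²`,
   `(Δ + 1/4 + r²)E_𝔞(·, r) = 0`, continuous in `r` — such that for every test function `f` on `F`
   (`IsFdTestOn`): `r ↦ ⟨E_𝔞(·, r), f⟩ ∈ L²(ℝ)` and **the Parseval identity**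
   `‖f‖² = Σ_j |⟨u_j, f⟩|² + (1/4π) Σ_𝔞 ∫ |⟨E_𝔞(·, r), f⟩|² dr` — (7.15)+(4.15) paired with `f`.
   Basic consequences: `λ_j ≥ 0` (`L2EigenvalueNonneg`), Bessel summability, spectral parameters
   `t(λ)` (`specT`: `√(λ - 1/4)` or `i√(1/4 - λ)`, `h(t(λ)) ∈ ℝ`), linearity of the coefficients.
2. (§2) PROVED, **polarization**: `∫_F f̄ g = Σ_j conj⟨u_j,f⟩⟨u_j,g⟩ + (1/4π)Σ_𝔞 ∫ conj⟨E_𝔞,f⟩⟨E_𝔞,g⟩`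
   (pointwise polarization of `ā b`, no `Lp` classes).
3. (§3) PROVED, the spectral coefficients of automorphic kernels `K(·, w)` (test functions by
   `SpectralTestFunctions`): `⟨u_j, K(·,w)⟩ = 2h(t_j)ū_j(w)`, `⟨E_𝔞(·,r), K(·,w)⟩ = 2h(r)Ē_𝔞(w,r)`
   (Theorem 1.16 by unfolding).
4. (§4) PROVED, **Proposition 7.2 (7.10) from the resolution**: the discrete half for the `u_j` with
   `λ_j ≥ 1/4` (`LocalWeylLaw.sum_norm_sq_eigenfunctions_le`) and the Eisenstein half
   `∫_{-T}^{T} |E_𝔞(z, r)|² dr ≤ 8192 N(z) T²` by Bessel's inequality for `K(·, z)` with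
   `k = 𝟙_{[0,δ]}`, `δ = (64T)⁻²`, as printed (p. 73).
5. (§5) PROVED, **Theorem 7.4 (7.17) from the resolution** (`automorphicKernel_eq_spectralExpansion`):
   for a continuous compactly supported `k` with admissible transform `h` ((1.63)) and all `z, w`,
   `Σ_{γ ∈ Γ} k(u(γz, w)) = 2[Σ_j h(t_j)u_j(z)ū_j(w) + (1/4π)Σ_𝔞 ∫ h(r)E_𝔞(z,r)Ē_𝔞(w,r) dr]`,
   absolutely convergent — the Parseval identity for the pair `K_{k_n}(·, z)`, `K_k(·, w)` with the
   approximate identity `k_n` of `ModularPretraceFromParseval` (`bump`; here `h_n(t) → 1` also for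
   the complex parameters `t = iθ` of the small eigenvalues, and `|h_n(iθ)| ≤ 1` for `|θ| ≤ 1/2`,
   i.e. `λ ≥ 0`), dominated convergence justified by (7.10) and the partial summation of
   `ModularPretrace` (majorant from (1.63)).
The third file turns the finitely many `u_j` with `λ_j < 1/4` into a `SmallEigenbasis` (completeness,
by the intertwining of `SpectralTestFunctions`) and produces `SpectralDatum Γ F B` for every `B`,
hence `Iwaniec2002_eq_12_5` from `∀ Γ F …, Nonempty (SpectralResolution Γ F)`.

What remains for whoever formalises Chapters 6–7 for a general `Γ` (the Eisenstein bricks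
`Fuchsian*` of the tree): construct `SpectralResolution Γ F` from the Hilbert basis of Maass cusp
forms (`FuchsianMaassCuspForms.exists_hilbertBasis_maassCuspForms`, Thm 4.7 general, in the tree), the
residues of `E_𝔞(z, s)` in `(1/2, 1]` and the continued `E_𝔞(z, 1/2 + ir)` with Theorem 7.3.

## References
* [Iwaniec2002] H. Iwaniec, *Spectral Methods of Automorphic Forms*, 2nd ed., GSM 53, AMS 2002,
  Thm 7.3 (7.15)–(7.16) & Thm 4.7 (4.15), PDF pp. 52, 75; Prop. 7.2 (7.10) & (7.8)–(7.9), PDF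
  pp. 71–73; Thm 7.4 (7.17), PDF p. 76; (1.63), PDF p. 24 (held copy
  `book:iwaniec2002-spectral-methods-automorphic-forms`).

Mathlib: `summable_of_sum_le`, `HasSum.tsum_eq`, `tendsto_tsum_of_dominated_convergence`,
`tendsto_integral_of_dominated_convergence`, `intervalIntegral.integral_mono_on`, `Real.cosh_le_cosh`.
Literature: `IsFdTestOn` & co., `setIntegral_conj_mul_automorphicKernel`, `isFdTestOn_automorphicKernel(_ballKernel)`,
`conj_selbergTransform`, `conj_selbergTransform_I_mul` (`SpectralTestFunctions`); `bump`, `isTestKernel_bump`,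
`continuous_bump`, `bump_nonneg`, `bump_eq_zero`, `integral_bump`, `selbergTransform_bump_I_half`,
`norm_selbergTransform_bump_le`, `tendsto_supportRadius`, `tendsto_invariantOperator_bump`,
`exists_majorant_of_admissible`, `conj_mul_eq_polar`, `conj_selbergTransform_ofReal`, `integrable_selbergG`
(`ModularPretraceFromParseval` — general lemmas housed in the modular file); `eigenvalue_real_nonneg_of_sqIntegrable`,
`selbergTransform_mul_I_eq`, `four_pi_integral_eq_integral_cosh_selbergG` (`L2EigenvalueNonneg`);
`Pretrace.tsum_spectral_le`, `Pretrace.integral_spectral_le` (`ModularPretrace`); `Bessel.sum_norm_sq_integral_le`,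
`sum_norm_sq_eigenfunctions_le`, `memLp_automorphicKernel_ballKernel`, `norm_selbergTransform_ballKernel_ge`,
`orbitCount`, `orbitCount_mono`, `ballKernel` (`LocalWeylLaw`); `setIntegral_automorphicKernel_mul`,
`automorphicKernel_comm`, `automorphicKernel_smul_left` (`FundamentalDomainUnfolding`); `selbergG_nonneg`
(`EisensteinOrthogonality`). Nothing of this kind for a general group existed (`lean search
'SpectralResolution|HasParseval|IsFdTest'`: the modular `HasModularParseval` only).
-/

noncomputable section

open MeasureTheory Set Filter Real UpperHalfPlane
open scoped Topology MatrixGroups ComplexConjugate NNReal ENNReal Pointwise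

namespace Literature.NumberTheory.Automorphic

/-! ## 1. The spectral resolution of `L²(Γ\ℍ)` as a hypothesis schema -/

section Schema

variable {Γ : Subgroup (GL (Fin 2) ℝ)} {F : Set ℍ}

/-- **The spectral resolution of `L²(Γ\ℍ)` tested on functions of compact support mod `Γ`**
(Theorems 4.7 and 7.3 with the residual spectrum, as a hypothesis schema; data, not a named fact).
A countable family `u_j` of automorphic `C²` functions, square-integrable and orthonormal on the
fundamental domain `F`, with `(Δ + λ_j)u_j = 0`, `λ_j ∈ ℝ`, finitely many `λ_j < 1/4` — in the book
the orthonormal basis of Maass cusp forms (Theorem 4.7) together with an orthonormal basis of the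
residues of the Eisenstein series at `1/2 < s_j ≤ 1` (§6.4, §7.3); and `c` eigenpackets
`E_𝔞(z, r)` — in the book `E_𝔞(z, 1/2 + ir)` at the `c = h` inequivalent cusps — automorphic `C²`
with `(Δ + 1/4 + r²)E_𝔞(·, r) = 0` and continuous in `r`; such that for every test function `f` on
`F` (`IsFdTestOn Γ F f`: bounded, measurable, compact support mod `Γ`) the Eisenstein coefficients
`r ↦ ∫_F Ē_𝔞(z, r) f(z) dμ(z)` are in `L²(ℝ)` and **Parseval's identity** holds:
`∫_F |f|² dμ = Σ_j |∫_F ū_j f dμ|² + (1/4π) Σ_𝔞 ∫_ℝ |∫_F Ē_𝔞(·, r) f dμ|² dr`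
((7.15) paired with `f`, plus (4.15) and the residual terms: "Combining Theorems 4.7 and 7.3 one
gets the spectral decomposition of the whole space `L²(Γ\ℍ)`", p. 75; (7.16) for the pointwise
form). For `SL₂(ℤ)` (`c = 1`, residual spectrum `u₀ = (3/π)^{1/2}`) this is `hasModularParseval` of
`ModularParseval.lean`. [cite: Iwaniec2002, Thm 7.3 (7.15)–(7.16) & Thm 4.7 (4.15), PDF pp. 52, 75] -/
structure SpectralResolution (Γ : Subgroup (GL (Fin 2) ℝ)) (F : Set ℍ) where
  /-- index set of the discrete spectrum -/
  ι : Type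
  countable_ι : Countable ι
  /-- the eigenvalues `λ_j` of the discrete spectrum -/
  lam : ι → ℝ
  /-- the eigenfunctions `u_j` (Maass cusp forms and residues of Eisenstein series) -/
  u : ι → ℍ → ℂ
  /-- the number of eigenpackets (inequivalent cusps; `0` for co-compact `Γ`) -/
  c : ℕ
  /-- the Eisenstein series on the critical line, `E 𝔞 z r = E_𝔞(z, 1/2 + ir)` -/
  E : Fin c → ℍ → ℝ → ℂ
  automorphic_u : ∀ j, IsAutomorphic Γ (u j)
  isC2_u : ∀ j, IsC2 (u j)
  eigen_u : ∀ j z, hypLaplacian (u j) z + (lam j : ℂ) * u j z = 0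
  sqIntegrable_u : ∀ j, IntegrableOn (fun z => ‖u j z‖ ^ 2) F
  norm_u : ∀ j, ∫ z in F, u j z * conj (u j z) = 1
  orthogonal_u : ∀ i j, i ≠ j → ∫ z in F, u i z * conj (u j z) = 0
  finite_small : {j | lam j < 1 / 4}.Finite
  automorphic_E : ∀ a r, IsAutomorphic Γ (fun z => E a z r)
  isC2_E : ∀ a r, IsC2 (fun z => E a z r)
  eigen_E : ∀ a r z, hypLaplacian (fun z => E a z r) z + ((1 / 4 + r ^ 2 : ℝ) : ℂ) * E a z r = 0
  continuous_E : ∀ a z, Continuous (E a z)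
  /-- the Eisenstein coefficients of a test function are square-integrable in `r` -/
  memLp_eisCoeff : ∀ f : ℍ → ℂ, IsFdTestOn Γ F f →
    ∀ a, MemLp (fun r : ℝ => ∫ z in F, conj (E a z r) * f z) 2 (volume : Measure ℝ)
  /-- the Parseval identity ((7.15) + (4.15) + residual spectrum) for test functions -/
  parseval : ∀ f : ℍ → ℂ, IsFdTestOn Γ F f →
    ∫ z in F, ‖f z‖ ^ 2 = (∑' j, ‖∫ z in F, conj (u j z) * f z‖ ^ 2) +
      1 / (4 * π) * ∑ a, ∫ r : ℝ, ‖∫ z in F, conj (E a z r) * f z‖ ^ 2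

/-- **The spectral parameter `t(λ)` of an eigenvalue**: `t = √(λ - 1/4) ∈ ℝ` if `λ ≥ 1/4` and
`t = i√(1/4 - λ)` (`= i(s - 1/2)`, `λ = s(1 - s)`, `1/2 < s`) otherwise; `1/4 + t² = λ`.
[cite: Iwaniec2002, §7.3 (the points `s_j = 1/2 + it_j`), PDF p. 75] -/
def specT (l : ℝ) : ℂ :=
  if 1 / 4 ≤ l then ((Real.sqrt (l - 1 / 4) : ℝ) : ℂ) else Complex.I * ((Real.sqrt (1 / 4 - l) : ℝ) : ℂ)

/-- `t(λ) = √(λ - 1/4)` for `λ ≥ 1/4`. [folklore] -/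
theorem specT_of_le {l : ℝ} (h : 1 / 4 ≤ l) : specT l = ((Real.sqrt (l - 1 / 4) : ℝ) : ℂ) := if_pos h

/-- `t(λ) = i√(1/4 - λ)` for `λ < 1/4`. [folklore] -/
theorem specT_of_lt {l : ℝ} (h : l < 1 / 4) : specT l = Complex.I * ((Real.sqrt (1 / 4 - l) : ℝ) : ℂ) :=
  if_neg (not_le.mpr h)

/-- `1/4 + t(λ)² = λ`. [folklore] -/
theorem quarter_add_specT_sq (l : ℝ) : (1 / 4 : ℂ) + specT l ^ 2 = l := by
  by_cases h : 1 / 4 ≤ l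
  · rw [specT_of_le h, ← Complex.ofReal_pow, Real.sq_sqrt (by linarith)]
    push_cast; ring
  · rw [specT_of_lt (not_le.mp h), mul_pow, Complex.I_sq, ← Complex.ofReal_pow, Real.sq_sqrt (by linarith)]
    push_cast; ring

/-- `h(t(λ)) ∈ ℝ` (`t(λ) ∈ ℝ ∪ iℝ`). [folklore] -/
theorem conj_selbergTransform_specT (k : ℝ → ℝ) (l : ℝ) :
    conj (selbergTransform k (specT l)) = selbergTransform k (specT l) := by
  by_cases h : 1 / 4 ≤ l
  · rw [specT_of_le h, conj_selbergTransform_ofReal]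
  · rw [specT_of_lt (not_le.mp h), conj_selbergTransform_I_mul]

/-- For `0 ≤ λ < 1/4`: `t(λ) = iθ` with `0 < θ ≤ 1/2`. [folklore] -/
theorem sqrt_quarter_sub_le {l : ℝ} (h0 : 0 ≤ l) : Real.sqrt (1 / 4 - l) ≤ 1 / 2 := by
  rw [show (1 / 2 : ℝ) = Real.sqrt (1 / 4) by rw [show (1 / 4 : ℝ) = (1 / 2) ^ 2 by norm_num,
    Real.sqrt_sq (by norm_num)]]
  exact Real.sqrt_le_sqrt (by linarith)

namespace SpectralResolution

variable (R : SpectralResolution Γ F)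

/-- The `u_j` are continuous. [folklore] -/
theorem continuous_u (j : R.ι) : Continuous (R.u j) := (R.isC2_u j).continuous

/-- The `u_j` are in `L²(F)`. [folklore] -/
theorem memLp_u (j : R.ι) : MemLp (R.u j) 2 (volume.restrict F) :=
  (memLp_two_iff_integrable_sq_norm (R.continuous_u j).aestronglyMeasurable.restrict).mpr (R.sqIntegrable_u j)

/-- Orthonormality in `δ`-form. [folklore] -/
theorem orthonormal (i j : R.ι) [Decidable (i = j)] :
    ∫ z in F, R.u i z * conj (R.u j z) = if i = j then 1 else 0 := by
  split_ifs with h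
  · subst h; exact R.norm_u i
  · exact R.orthogonal_u i j h

/-- The eigen-equation of `u_j` in `t`-form: `(Δ + 1/4 + t(λ_j)²)u_j = 0`. [folklore] -/
theorem eigen_u_specT (j : R.ι) (z : ℍ) :
    hypLaplacian (R.u j) z + (1 / 4 + specT (R.lam j) ^ 2) * R.u j z = 0 :=
  eigen_of_real (R.eigen_u j) (quarter_add_specT_sq _) z

/-- `u_j ≠ 0` in `L²(F)` (it has norm one). [folklore] -/
theorem not_ae_eq_zero_u (j : R.ι) : ¬ R.u j =ᵐ[volume.restrict F] 0 := by
  intro h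
  have h1 := R.norm_u j
  have h0 : ∫ z in F, R.u j z * conj (R.u j z) = 0 := by
    rw [← integral_zero (α := ℍ)]
    refine integral_congr_ae ?_
    filter_upwards [h] with z hz
    simp [hz]
  rw [h0] at h1
  exact zero_ne_one h1

/-- **The eigenvalues are non-negative**: `λ_j ≥ 0` (`Δ` has only non-negative eigenvalues on
`L²(Γ\ℍ)`, Lemma 4.1 / (4.3); general-`Γ` version of `L2EigenvalueNonneg`).
[cite: Iwaniec2002, Lemma 4.1 & (4.3), PDF p. 48] -/
theorem lam_nonneg (hΓ : Γ ≤ (Matrix.SpecialLinearGroup.toGL : SL(2, ℝ) →* GL (Fin 2) ℝ).range)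
    (hneg : (-1 : GL (Fin 2) ℝ) ∈ Γ) (hd : IsDiscreteSubgroup Γ) (hF : IsHypFundamentalDomain Γ F) (j : R.ι) :
    0 ≤ R.lam j := by
  have h := (eigenvalue_real_nonneg_of_sqIntegrable hΓ hneg hd hF (R.automorphic_u j) (R.isC2_u j)
    (R.eigen_u_specT j) (R.memLp_u j) (R.not_ae_eq_zero_u j)).2
  rwa [quarter_add_specT_sq, Complex.ofReal_re] at h

/-! ### The spectral coefficients of a test function -/

/-- The discrete coefficient `⟨u_j, f⟩ = ∫_F ū_j f dμ`. [cite: Iwaniec2002, (4.15) & (7.16), PDF pp. 52, 75] -/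
def coeff (j : R.ι) (f : ℍ → ℂ) : ℂ := ∫ z in F, conj (R.u j z) * f z

/-- The Eisenstein coefficient `⟨E_𝔞(·, r), f⟩ = ∫_F Ē_𝔞(z, r) f(z) dμ(z)`.
[cite: Iwaniec2002, Thm 7.3 (7.15), PDF p. 75] -/
def eisCoeff (a : Fin R.c) (f : ℍ → ℂ) (r : ℝ) : ℂ := ∫ z in F, conj (R.E a z r) * f z

/-- Parseval in coefficient notation. [cite: Iwaniec2002, Thm 7.3 (7.15) & Thm 4.7 (4.15), PDF pp. 52, 75] -/
theorem parseval_eq {f : ℍ → ℂ} (hf : IsFdTestOn Γ F f) :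
    ∫ z in F, ‖f z‖ ^ 2 = (∑' j, ‖R.coeff j f‖ ^ 2) + 1 / (4 * π) * ∑ a, ∫ r : ℝ, ‖R.eisCoeff a f r‖ ^ 2 :=
  R.parseval f hf

/-- The Eisenstein coefficients of a test function are in `L²(ℝ)`. [cite: Iwaniec2002, Thm 7.3, PDF p. 75] -/
theorem memLp_eisCoeff' {f : ℍ → ℂ} (hf : IsFdTestOn Γ F f) (a : Fin R.c) :
    MemLp (R.eisCoeff a f) 2 (volume : Measure ℝ) :=
  R.memLp_eisCoeff f hf a

/-- `r ↦ |⟨E_𝔞(·,r), f⟩|²` is integrable. [folklore] -/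
theorem integrable_eisCoeff_sq {f : ℍ → ℂ} (hf : IsFdTestOn Γ F f) (a : Fin R.c) :
    Integrable (fun r : ℝ => ‖R.eisCoeff a f r‖ ^ 2) :=
  (memLp_two_iff_integrable_sq_norm (R.memLp_eisCoeff' hf a).1).mp (R.memLp_eisCoeff' hf a)

/-- `ū_j f` is integrable on `F` for a test function `f`. [folklore] -/
theorem integrable_conj_u_mul (hvol : volume F < ⊤) (hFm : MeasurableSet F) {f : ℍ → ℂ} (hf : IsFdTestOn Γ F f) (j : R.ι) :
    Integrable (fun z => conj (R.u j z) * f z) (volume.restrict F) :=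
  (hf.automorphic_mul (R.automorphic_u j).conj (Complex.continuous_conj.comp (R.continuous_u j))).integrable hFm hvol

/-- `Ē_𝔞(·, r) f` is integrable on `F` for a test function `f`. [folklore] -/
theorem integrable_conj_E_mul (hvol : volume F < ⊤) (hFm : MeasurableSet F) {f : ℍ → ℂ} (hf : IsFdTestOn Γ F f) (a : Fin R.c) (r : ℝ) :
    Integrable (fun z => conj (R.E a z r) * f z) (volume.restrict F) :=
  (hf.automorphic_mul (R.automorphic_E a r).conj
    (Complex.continuous_conj.comp (R.isC2_E a r).continuous)).integrable hFm hvol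

/-- Additivity of the discrete coefficients. [folklore] -/
theorem coeff_add (hvol : volume F < ⊤) (hFm : MeasurableSet F) {f g : ℍ → ℂ} (hf : IsFdTestOn Γ F f) (hg : IsFdTestOn Γ F g) (j : R.ι) :
    R.coeff j (f + g) = R.coeff j f + R.coeff j g := by
  unfold coeff
  rw [← integral_add (R.integrable_conj_u_mul hvol hFm hf j) (R.integrable_conj_u_mul hvol hFm hg j)]
  congr 1 with z
  simp only [Pi.add_apply]; ring

/-- Homogeneity of the discrete coefficients. [folklore] -/
theorem coeff_smul (c : ℂ) (f : ℍ → ℂ) (j : R.ι) : R.coeff j (c • f) = c * R.coeff j f := by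
  unfold coeff
  rw [← integral_const_mul]
  congr 1 with z
  simp only [Pi.smul_apply, smul_eq_mul]; ring

/-- Additivity of the Eisenstein coefficients. [folklore] -/
theorem eisCoeff_add (hvol : volume F < ⊤) (hFm : MeasurableSet F) {f g : ℍ → ℂ} (hf : IsFdTestOn Γ F f) (hg : IsFdTestOn Γ F g) (a : Fin R.c) (r : ℝ) :
    R.eisCoeff a (f + g) r = R.eisCoeff a f r + R.eisCoeff a g r := by
  unfold eisCoeff
  rw [← integral_add (R.integrable_conj_E_mul hvol hFm hf a r) (R.integrable_conj_E_mul hvol hFm hg a r)]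
  congr 1 with z
  simp only [Pi.add_apply]; ring

/-- Homogeneity of the Eisenstein coefficients. [folklore] -/
theorem eisCoeff_smul (c : ℂ) (f : ℍ → ℂ) (a : Fin R.c) (r : ℝ) :
    R.eisCoeff a (c • f) r = c * R.eisCoeff a f r := by
  unfold eisCoeff
  rw [← integral_const_mul]
  congr 1 with z
  simp only [Pi.smul_apply, smul_eq_mul]; ring

/-! ### Bessel's inequality for the discrete family -/

/-- **Bessel's inequality**: `Σ_{j ∈ S} |⟨u_j, f⟩|² ≤ ∫_F |f|²` for finite `S` and `f ∈ L²(F)`.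
[cite: Iwaniec2002, (7.8), PDF p. 71] -/
theorem sum_coeff_sq_le {f : ℍ → ℂ} (hf : MemLp f 2 (volume.restrict F)) (S : Finset R.ι) :
    ∑ j ∈ S, ‖R.coeff j f‖ ^ 2 ≤ ∫ z in F, ‖f z‖ ^ 2 := by
  classical
  have h := Bessel.sum_norm_sq_integral_le S hf (fun j _ => R.memLp_u j) (fun i _ j _ => R.orthonormal i j)
  refine le_trans (le_of_eq (Finset.sum_congr rfl fun j _ => ?_)) h
  unfold coeff
  congr 2
  exact integral_congr_ae (Eventually.of_forall fun z => mul_comm _ _)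

/-- **Summability of `Σ_j |⟨u_j, f⟩|²`** for `f ∈ L²(F)` (Bessel). [cite: Iwaniec2002, (7.8), PDF p. 71] -/
theorem summable_coeff_sq {f : ℍ → ℂ} (hf : MemLp f 2 (volume.restrict F)) :
    Summable fun j => ‖R.coeff j f‖ ^ 2 :=
  summable_of_sum_le (fun j => by positivity) (R.sum_coeff_sq_le hf)

/-- `Σ_j |⟨u_j, f⟩|² ≤ ∫_F |f|²`. [cite: Iwaniec2002, (7.8), PDF p. 71] -/
theorem tsum_coeff_sq_le {f : ℍ → ℂ} (hf : MemLp f 2 (volume.restrict F)) :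
    ∑' j, ‖R.coeff j f‖ ^ 2 ≤ ∫ z in F, ‖f z‖ ^ 2 :=
  (R.summable_coeff_sq hf).tsum_le_of_sum_le (R.sum_coeff_sq_le hf)

/-- `|ā b| ≤ (|a|² + |b|²)/2`. [folklore] -/
theorem norm_conj_mul_le (a b : ℂ) : ‖conj a * b‖ ≤ (‖a‖ ^ 2 + ‖b‖ ^ 2) / 2 := by
  rw [norm_mul, Complex.norm_conj]
  nlinarith [sq_nonneg (‖a‖ - ‖b‖)]

/-- `Σ_j conj⟨u_j,f⟩⟨u_j,g⟩` converges absolutely for `f, g ∈ L²(F)`. [folklore] -/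
theorem summable_norm_conj_coeff_mul_coeff {f g : ℍ → ℂ} (hf : MemLp f 2 (volume.restrict F))
    (hg : MemLp g 2 (volume.restrict F)) :
    Summable fun j => ‖conj (R.coeff j f) * R.coeff j g‖ :=
  Summable.of_nonneg_of_le (fun _ => norm_nonneg _) (fun _ => norm_conj_mul_le _ _)
    (((R.summable_coeff_sq hf).add (R.summable_coeff_sq hg)).div_const 2)

end SpectralResolution

end Schema

/-! ## 2. Polarization: the Parseval identity in sesquilinear form -/

section Polarization

variable {Γ : Subgroup (GL (Fin 2) ℝ)} {F : Set ℍ}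

/-- Pointwise polarization integrated: `∫ f̄ g = (∫|f+g|² - ∫|f-g|² + (∫|f-ig|² - ∫|f+ig|²) i)/4`
for `f, g ∈ L²(μ)`. [folklore] -/
theorem integral_conj_mul_eq_polar {X : Type*} [MeasurableSpace X] {μ : Measure X} {f g : X → ℂ}
    (hf : MemLp f 2 μ) (hg : MemLp g 2 μ) :
    ∫ x, conj (f x) * g x ∂μ =
      (((∫ x, ‖f x + g x‖ ^ 2 ∂μ : ℝ) : ℂ) - ((∫ x, ‖f x - g x‖ ^ 2 ∂μ : ℝ) : ℂ) +
        (((∫ x, ‖f x - Complex.I * g x‖ ^ 2 ∂μ : ℝ) : ℂ) - ((∫ x, ‖f x + Complex.I * g x‖ ^ 2 ∂μ : ℝ) : ℂ)) *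
          Complex.I) / 4 := by
  have hI : MemLp (fun x => Complex.I * g x) 2 μ := hg.const_mul Complex.I
  have i1 : Integrable (fun x => ‖f x + g x‖ ^ 2) μ := (hf.add hg).integrable_norm_pow two_ne_zero
  have i2 : Integrable (fun x => ‖f x - g x‖ ^ 2) μ := (hf.sub hg).integrable_norm_pow two_ne_zero
  have i3 : Integrable (fun x => ‖f x - Complex.I * g x‖ ^ 2) μ := (hf.sub hI).integrable_norm_pow two_ne_zero
  have i4 : Integrable (fun x => ‖f x + Complex.I * g x‖ ^ 2) μ := (hf.add hI).integrable_norm_pow two_ne_zero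
  have key : ∀ x, conj (f x) * g x =
      ((((‖f x + g x‖ ^ 2 : ℝ) : ℂ) - ((‖f x - g x‖ ^ 2 : ℝ) : ℂ)) +
        (((‖f x - Complex.I * g x‖ ^ 2 : ℝ) : ℂ) - ((‖f x + Complex.I * g x‖ ^ 2 : ℝ) : ℂ)) * Complex.I) / 4 := by
    intro x
    have h := conj_mul_eq_polar (f x) (g x)
    push_cast at h ⊢
    exact h
  have j12 : Integrable (fun x => ((‖f x + g x‖ ^ 2 : ℝ) : ℂ) - ((‖f x - g x‖ ^ 2 : ℝ) : ℂ)) μ :=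
    i1.ofReal.sub i2.ofReal
  have j34 : Integrable (fun x => (((‖f x - Complex.I * g x‖ ^ 2 : ℝ) : ℂ) -
      ((‖f x + Complex.I * g x‖ ^ 2 : ℝ) : ℂ)) * Complex.I) μ := (i3.ofReal.sub i4.ofReal).mul_const _
  rw [integral_congr_ae (Eventually.of_forall key), integral_div, integral_add j12 j34,
    integral_sub i1.ofReal i2.ofReal, integral_mul_const, integral_sub i3.ofReal i4.ofReal,
    integral_complex_ofReal, integral_complex_ofReal, integral_complex_ofReal, integral_complex_ofReal]

/-- Termwise polarization summed: `Σ' ā_j b_j = (Σ'|a+b|² - Σ'|a-b|² + (Σ'|a-ib|² - Σ'|a+ib|²) i)/4`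
when the four square families are summable. [folklore] -/
theorem tsum_conj_mul_eq_polar {ι : Type*} {a b : ι → ℂ}
    (h1 : Summable fun j => ‖a j + b j‖ ^ 2) (h2 : Summable fun j => ‖a j - b j‖ ^ 2)
    (h3 : Summable fun j => ‖a j - Complex.I * b j‖ ^ 2) (h4 : Summable fun j => ‖a j + Complex.I * b j‖ ^ 2) :
    ∑' j, conj (a j) * b j =
      (((∑' j, ‖a j + b j‖ ^ 2 : ℝ) : ℂ) - ((∑' j, ‖a j - b j‖ ^ 2 : ℝ) : ℂ) +
        (((∑' j, ‖a j - Complex.I * b j‖ ^ 2 : ℝ) : ℂ) - ((∑' j, ‖a j + Complex.I * b j‖ ^ 2 : ℝ) : ℂ)) *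
          Complex.I) / 4 := by
  have H1 := (Complex.hasSum_ofReal.mpr h1.hasSum)
  have H2 := (Complex.hasSum_ofReal.mpr h2.hasSum)
  have H3 := (Complex.hasSum_ofReal.mpr h3.hasSum)
  have H4 := (Complex.hasSum_ofReal.mpr h4.hasSum)
  have H := ((H1.sub H2).add ((H3.sub H4).mul_right Complex.I)).div_const 4
  have hfun : (fun j => conj (a j) * b j) = fun j =>
      ((((‖a j + b j‖ ^ 2 : ℝ) : ℂ) - ((‖a j - b j‖ ^ 2 : ℝ) : ℂ)) +
        (((‖a j - Complex.I * b j‖ ^ 2 : ℝ) : ℂ) - ((‖a j + Complex.I * b j‖ ^ 2 : ℝ) : ℂ)) * Complex.I) / 4 := by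
    funext j
    have h := conj_mul_eq_polar (a j) (b j)
    push_cast at h ⊢
    exact h
  rw [hfun]
  exact H.tsum_eq

namespace SpectralResolution

variable (R : SpectralResolution Γ F) (hvol : volume F < ⊤) (hFm : MeasurableSet F)
include hvol hFm

/-- **The Parseval identity in sesquilinear form**: for test functions `f, g` on `F`,
`∫_F f̄ g dμ = Σ_j conj⟨u_j, f⟩ ⟨u_j, g⟩ + (1/4π) Σ_𝔞 ∫ conj⟨E_𝔞(·,r), f⟩ ⟨E_𝔞(·,r), g⟩ dr`
((7.15)–(7.16) paired with `g`; polarization of `parseval`). [cite: Iwaniec2002, Thm 7.3 (7.15)–(7.16), PDF p. 75] -/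
theorem parseval_polar {f g : ℍ → ℂ} (hf : IsFdTestOn Γ F f) (hg : IsFdTestOn Γ F g) :
    ∫ z in F, conj (f z) * g z =
      (∑' j, conj (R.coeff j f) * R.coeff j g) +
        1 / (4 * π) * ∑ a, ∫ r : ℝ, conj (R.eisCoeff a f r) * R.eisCoeff a g r := by
  -- the four polar combinations are test functions
  have hI : IsFdTestOn Γ F (Complex.I • g) := hg.const_smul Complex.I
  have h1 : IsFdTestOn Γ F (f + g) := hf.add hg
  have h2 : IsFdTestOn Γ F (f - g) := hf.sub hg
  have h3 : IsFdTestOn Γ F (f - Complex.I • g) := hf.sub hI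
  have h4 : IsFdTestOn Γ F (f + Complex.I • g) := hf.add hI
  have hf2 := hf.memLp_two hFm hvol
  have hg2 := hg.memLp_two hFm hvol
  -- Parseval for the four combinations
  have P1 := R.parseval_eq h1
  have P2 := R.parseval_eq h2
  have P3 := R.parseval_eq h3
  have P4 := R.parseval_eq h4
  -- the coefficients of the combinations
  have c1 : ∀ j, R.coeff j (f + g) = R.coeff j f + R.coeff j g := fun j => R.coeff_add hvol hFm hf hg j
  have c2 : ∀ j, R.coeff j (f - g) = R.coeff j f - R.coeff j g := fun j => by
    rw [sub_eq_add_neg, show -g = (-1 : ℂ) • g by funext z; simp, R.coeff_add hvol hFm hf (hg.const_smul _),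
      R.coeff_smul]; ring
  have c3 : ∀ j, R.coeff j (f - Complex.I • g) = R.coeff j f - Complex.I * R.coeff j g := fun j => by
    rw [sub_eq_add_neg, show -(Complex.I • g) = (-1 : ℂ) • (Complex.I • g) by funext z; simp,
      R.coeff_add hvol hFm hf (hI.const_smul _), R.coeff_smul, R.coeff_smul]; ring
  have c4 : ∀ j, R.coeff j (f + Complex.I • g) = R.coeff j f + Complex.I * R.coeff j g := fun j => by
    rw [R.coeff_add hvol hFm hf hI, R.coeff_smul]
  have e1 : ∀ a r, R.eisCoeff a (f + g) r = R.eisCoeff a f r + R.eisCoeff a g r :=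
    fun a r => R.eisCoeff_add hvol hFm hf hg a r
  have e2 : ∀ a r, R.eisCoeff a (f - g) r = R.eisCoeff a f r - R.eisCoeff a g r := fun a r => by
    rw [sub_eq_add_neg, show -g = (-1 : ℂ) • g by funext z; simp, R.eisCoeff_add hvol hFm hf (hg.const_smul _),
      R.eisCoeff_smul]; ring
  have e3 : ∀ a r, R.eisCoeff a (f - Complex.I • g) r = R.eisCoeff a f r - Complex.I * R.eisCoeff a g r := fun a r => by
    rw [sub_eq_add_neg, show -(Complex.I • g) = (-1 : ℂ) • (Complex.I • g) by funext z; simp,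
      R.eisCoeff_add hvol hFm hf (hI.const_smul _), R.eisCoeff_smul, R.eisCoeff_smul]; ring
  have e4 : ∀ a r, R.eisCoeff a (f + Complex.I • g) r = R.eisCoeff a f r + Complex.I * R.eisCoeff a g r := fun a r => by
    rw [R.eisCoeff_add hvol hFm hf hI, R.eisCoeff_smul]
  simp_rw [c1, e1] at P1
  simp_rw [c2, e2] at P2
  simp_rw [c3, e3] at P3
  simp_rw [c4, e4] at P4
  -- complexified Parseval identities
  have cplx : ∀ {I S : ℝ} {T : Fin R.c → ℝ}, I = S + 1 / (4 * π) * ∑ a, T a →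
      ((I : ℝ) : ℂ) = (S : ℂ) + 1 / (4 * π) * ∑ a, ((T a : ℝ) : ℂ) := by
    intro I S T h
    rw [h]
    push_cast
    rfl
  have E1 := cplx P1
  have E2 := cplx P2
  have E3 := cplx P3
  have E4 := cplx P4
  -- (i) polarization of the left-hand side
  have pol1 := integral_conj_mul_eq_polar hf2 hg2
  -- (ii) polarization of the discrete part
  have s1 : Summable fun j => ‖R.coeff j f + R.coeff j g‖ ^ 2 := by
    have := R.summable_coeff_sq (h1.memLp_two hFm hvol); simp_rw [c1] at this; exact this
  have s2 : Summable fun j => ‖R.coeff j f - R.coeff j g‖ ^ 2 := by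
    have := R.summable_coeff_sq (h2.memLp_two hFm hvol); simp_rw [c2] at this; exact this
  have s3 : Summable fun j => ‖R.coeff j f - Complex.I * R.coeff j g‖ ^ 2 := by
    have := R.summable_coeff_sq (h3.memLp_two hFm hvol); simp_rw [c3] at this; exact this
  have s4 : Summable fun j => ‖R.coeff j f + Complex.I * R.coeff j g‖ ^ 2 := by
    have := R.summable_coeff_sq (h4.memLp_two hFm hvol); simp_rw [c4] at this; exact this
  have pol2 := tsum_conj_mul_eq_polar s1 s2 s3 s4
  -- (iii) polarization of the Eisenstein parts
  have pol3 : ∀ a, ∫ r : ℝ, conj (R.eisCoeff a f r) * R.eisCoeff a g r =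
      (((∫ r : ℝ, ‖R.eisCoeff a f r + R.eisCoeff a g r‖ ^ 2 : ℝ) : ℂ) -
        ((∫ r : ℝ, ‖R.eisCoeff a f r - R.eisCoeff a g r‖ ^ 2 : ℝ) : ℂ) +
        (((∫ r : ℝ, ‖R.eisCoeff a f r - Complex.I * R.eisCoeff a g r‖ ^ 2 : ℝ) : ℂ) -
          ((∫ r : ℝ, ‖R.eisCoeff a f r + Complex.I * R.eisCoeff a g r‖ ^ 2 : ℝ) : ℂ)) * Complex.I) / 4 :=
    fun a => integral_conj_mul_eq_polar (R.memLp_eisCoeff' hf a) (R.memLp_eisCoeff' hg a)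
  -- the integrands of (i) are those of the Parseval identities
  have q1 : ∫ z in F, ‖f z + g z‖ ^ 2 = ∫ z in F, ‖(f + g) z‖ ^ 2 := rfl
  have q2 : ∫ z in F, ‖f z - g z‖ ^ 2 = ∫ z in F, ‖(f - g) z‖ ^ 2 := rfl
  have q3 : ∫ z in F, ‖f z - Complex.I * g z‖ ^ 2 = ∫ z in F, ‖(f - Complex.I • g) z‖ ^ 2 := rfl
  have q4 : ∫ z in F, ‖f z + Complex.I * g z‖ ^ 2 = ∫ z in F, ‖(f + Complex.I • g) z‖ ^ 2 := rfl
  have pol3sum : ∑ a, ∫ r : ℝ, conj (R.eisCoeff a f r) * R.eisCoeff a g r =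
      ((∑ a, ((∫ r : ℝ, ‖R.eisCoeff a f r + R.eisCoeff a g r‖ ^ 2 : ℝ) : ℂ)) -
        (∑ a, ((∫ r : ℝ, ‖R.eisCoeff a f r - R.eisCoeff a g r‖ ^ 2 : ℝ) : ℂ)) +
        ((∑ a, ((∫ r : ℝ, ‖R.eisCoeff a f r - Complex.I * R.eisCoeff a g r‖ ^ 2 : ℝ) : ℂ)) -
          (∑ a, ((∫ r : ℝ, ‖R.eisCoeff a f r + Complex.I * R.eisCoeff a g r‖ ^ 2 : ℝ) : ℂ))) * Complex.I) / 4 := by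
    rw [Finset.sum_congr rfl fun a _ => pol3 a, ← Finset.sum_div, Finset.sum_add_distrib, Finset.sum_sub_distrib,
      ← Finset.sum_mul, Finset.sum_sub_distrib]
  rw [pol1, q1, q2, q3, q4, pol2, pol3sum]
  linear_combination (E1 - E2 + (E3 - E4) * Complex.I) / 4

end SpectralResolution

end Polarization

/-! ## 3. The spectral coefficients of automorphic kernels -/

section KernelCoefficients

variable {Γ : Subgroup (GL (Fin 2) ℝ)} {F : Set ℍ} {k : ℝ → ℝ}
variable (hΓ : Γ ≤ (Matrix.SpecialLinearGroup.toGL : SL(2, ℝ) →* GL (Fin 2) ℝ).range)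
  (hneg : (-1 : GL (Fin 2) ℝ) ∈ Γ) (hd : IsDiscreteSubgroup Γ) (hF : IsHypFundamentalDomain Γ F)
include hΓ hneg hd hF

omit hneg hF in
/-- Automorphic kernels are automorphic in the first variable (general `Γ`; the modular case is
`isAutomorphic_automorphicKernel`). [folklore] -/
theorem automorphicKernel_isAutomorphic (hk : IsTestKernel k) (w : ℍ) :
    IsAutomorphic Γ (fun v => (automorphicKernel Γ k v w : ℂ)) := by
  obtain ⟨_, _, ⟨M, _, hM⟩⟩ := hk
  intro γ hγ v
  simp only
  rw [automorphicKernel_smul_left hΓ hd hM hγ v w]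

namespace SpectralResolution

variable (R : SpectralResolution Γ F)

/-- **The discrete coefficients of `K(·, w)`**: `⟨u_j, K(·, w)⟩ = 2 h(t_j) ū_j(w)` (Theorem 1.16 and
unfolding; `t_j = t(λ_j)`). [cite: Iwaniec2002, §7.4, PDF p. 76] -/
theorem coeff_automorphicKernel (hk : IsTestKernel k) (j : R.ι) (w : ℍ) :
    R.coeff j (fun z => (automorphicKernel Γ k z w : ℂ)) = 2 * selbergTransform k (specT (R.lam j)) * conj (R.u j w) :=
  setIntegral_conj_mul_automorphicKernel hΓ hneg hd hF hk (R.automorphic_u j) (R.isC2_u j) (R.eigen_u j)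
    (quarter_add_specT_sq _) w

/-- **The Eisenstein coefficients of `K(·, w)`**: `⟨E_𝔞(·, r), K(·, w)⟩ = 2 h(r) Ē_𝔞(w, r)`.
[cite: Iwaniec2002, §7.4, PDF p. 76] -/
theorem eisCoeff_automorphicKernel (hk : IsTestKernel k) (a : Fin R.c) (w : ℍ) (r : ℝ) :
    R.eisCoeff a (fun z => (automorphicKernel Γ k z w : ℂ)) r = 2 * selbergTransform k r * conj (R.E a w r) :=
  setIntegral_conj_mul_automorphicKernel hΓ hneg hd hF hk (R.automorphic_E a r) (R.isC2_E a r) (R.eigen_E a r)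
    (by push_cast; ring) w

end SpectralResolution

end KernelCoefficients

/-! ## 4. Proposition 7.2 (7.10) from the resolution -/

section LocalWeyl

variable {Γ : Subgroup (GL (Fin 2) ℝ)} {F : Set ℍ}
variable (hΓ : Γ ≤ (Matrix.SpecialLinearGroup.toGL : SL(2, ℝ) →* GL (Fin 2) ℝ).range)
  (hneg : (-1 : GL (Fin 2) ℝ) ∈ Γ) (hd : IsDiscreteSubgroup Γ) (hF : IsHypFundamentalDomain Γ F)

namespace SpectralResolution

variable (R : SpectralResolution Γ F)

/-- The real spectral parameter `t_j = √(λ_j - 1/4)` (meaningful for `λ_j ≥ 1/4`). [cite: Iwaniec2002, §7.3, PDF p. 75] -/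
def tR (j : R.ι) : ℝ := Real.sqrt (R.lam j - 1 / 4)

/-- For `λ_j ≥ 1/4`: `t(λ_j) = t_j ∈ ℝ`. [folklore] -/
theorem specT_eq_tR {j : R.ι} (h : 1 / 4 ≤ R.lam j) : specT (R.lam j) = (R.tR j : ℂ) := specT_of_le h

/-- For `λ_j ≥ 1/4`: `(Δ + 1/4 + t_j²)u_j = 0` with `t_j ∈ ℝ`. [folklore] -/
theorem eigen_u_tR {j : R.ι} (h : 1 / 4 ≤ R.lam j) (z : ℍ) :
    hypLaplacian (R.u j) z + (1 / 4 + (R.tR j : ℂ) ^ 2) * R.u j z = 0 := by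
  have h' := R.eigen_u_specT j z
  rwa [R.specT_eq_tR h] at h'

include hΓ hneg hd hF

/-- **(7.10), discrete part** for the `u_j` with `λ_j ≥ 1/4`: for `T ≥ 1` and a finite set `S` of
indices with `λ_j ≥ 1/4`, `|t_j| < T`: `Σ_{j ∈ S} |u_j(z)|² ≤ (2048/π) N(z) T²`
(`LocalWeylLaw.sum_norm_sq_eigenfunctions_le`). [cite: Iwaniec2002, Prop. 7.2 (7.10), PDF p. 73] -/
theorem localWeyl_discrete (z : ℍ) {T : ℝ} (hT : 1 ≤ T) (S : Finset R.ι)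
    (hS : ∀ j ∈ S, 1 / 4 ≤ R.lam j ∧ |R.tR j| < T) :
    ∑ j ∈ S, ‖R.u j z‖ ^ 2 ≤ (2048 / π) * orbitCount Γ (1 / 4096) z * T ^ 2 := by
  classical
  exact sum_norm_sq_eigenfunctions_le hΓ hneg hd hF S R.u R.tR (fun j _ => R.automorphic_u j)
    (fun j _ => R.isC2_u j) (fun j hj => R.eigen_u_tR (hS j hj).1) (fun j _ => R.memLp_u j)
    (fun i _ j _ => R.orthonormal i j) hT (fun j hj => (hS j hj).2) z

/-- **(7.10), Eisenstein part, from the resolution** (general-`Γ` version of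
`eisenstein_localWeyl_of_parseval`): for every `z` there is `A` with `∫_{-T}^{T} |E_𝔞(z, r)|² dr ≤ A T²`
for all `T ≥ 1` and all `𝔞` — Bessel's inequality `(1/4π)∫|⟨E_𝔞(·,r), K⟩|² dr ≤ ‖K‖²` (from Parseval)
for `K = K(·, z)` with the kernel `𝟙_{[0,δ]}`, `δ = (64T)⁻²`, the coefficients `2h(r)Ē_𝔞(z, r)` with
`|h(r)| ≥ 2πδ` on `[-T, T]`, and `‖K‖² ≤ 8πδ N_δ(z)` by unfolding; `A = 8192 N(z)`.
[cite: Iwaniec2002, Prop. 7.2 (7.10) & its proof, PDF pp. 72–73] -/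
theorem localWeyl_eisenstein (z : ℍ) :
    ∃ A : ℝ, ∀ T : ℝ, 1 ≤ T → ∀ a, ∫ r in (-T)..T, ‖R.E a z r‖ ^ 2 ≤ A * T ^ 2 := by
  refine ⟨8192 * orbitCount Γ (1 / 4096) z, fun T hT a => ?_⟩
  -- the parameter δ = (64 T)⁻²
  set δ : ℝ := ((64 * T) ^ 2)⁻¹ with hδdef
  have hT0 : 0 < T := by linarith
  have hδ : 0 < δ := by rw [hδdef]; positivity
  have hδ' : δ ≤ 1 / 4096 := by
    rw [hδdef, inv_le_comm₀ (by positivity) (by norm_num)]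
    nlinarith
  have hsq : Real.sqrt δ = (64 * T)⁻¹ := by
    rw [hδdef, Real.sqrt_inv, Real.sqrt_sq (by positivity)]
  have hk := isTestKernel_ballKernel hδ.le
  set Ff : ℍ → ℂ := fun w => (automorphicKernel Γ (ballKernel δ) w z : ℂ) with hFf
  have hFt : IsFdTestOn Γ F Ff := isFdTestOn_automorphicKernel_ballKernel hΓ hd hδ.le z
  have hP := R.parseval_eq hFt
  -- ‖F‖² ≤ 2 N_δ 4πδ
  obtain ⟨_, hKint⟩ := memLp_automorphicKernel_ballKernel hΓ hneg hd hF hδ.le z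
  -- Bessel: (1/4π) ∫ |c_F|² ≤ ∫ |F|²
  have hBessel : 1 / (4 * π) * ∫ r : ℝ, ‖R.eisCoeff a Ff r‖ ^ 2 ≤ 2 * orbitCount Γ δ z * (4 * π * δ) := by
    have h1 : 0 ≤ ∑' j, ‖R.coeff j Ff‖ ^ 2 := tsum_nonneg fun j => by positivity
    have h2 : ∫ r : ℝ, ‖R.eisCoeff a Ff r‖ ^ 2 ≤ ∑ b, ∫ r : ℝ, ‖R.eisCoeff b Ff r‖ ^ 2 :=
      Finset.single_le_sum (f := fun b => ∫ r : ℝ, ‖R.eisCoeff b Ff r‖ ^ 2)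
        (fun b _ => integral_nonneg fun r => by positivity) (Finset.mem_univ a)
    have h3 : 1 / (4 * π) * ∫ r : ℝ, ‖R.eisCoeff a Ff r‖ ^ 2 ≤ ∫ w in F, ‖Ff w‖ ^ 2 := by
      rw [hP]
      have := mul_le_mul_of_nonneg_left h2 (by positivity : (0 : ℝ) ≤ 1 / (4 * π))
      linarith
    exact h3.trans hKint
  -- the coefficients
  have hcoef : ∀ r : ℝ, ‖R.eisCoeff a Ff r‖ ^ 2 =
      4 * ‖selbergTransform (ballKernel δ) r‖ ^ 2 * ‖R.E a z r‖ ^ 2 := by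
    intro r
    rw [hFf, R.eisCoeff_automorphicKernel hΓ hneg hd hF hk a z r, norm_mul, norm_mul, Complex.norm_two,
      Complex.norm_conj]
    ring
  -- lower bound for h on [-T, T]
  have hh : ∀ r : ℝ, |r| ≤ T → 2 * π * δ ≤ ‖selbergTransform (ballKernel δ) r‖ := by
    intro r hr
    refine norm_selbergTransform_ballKernel_ge hδ (hδ'.trans (by norm_num)) (r : ℂ) ?_
    have hs : ‖(1 / 2 : ℂ) + Complex.I * (r : ℂ)‖ ≤ 1 / 2 + |r| := by
      calc ‖(1 / 2 : ℂ) + Complex.I * (r : ℂ)‖ ≤ ‖(1 / 2 : ℂ)‖ + ‖Complex.I * (r : ℂ)‖ :=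
            norm_add_le _ _
        _ = 1 / 2 + |r| := by
            rw [norm_mul, Complex.norm_I, one_mul, Complex.norm_real, Real.norm_eq_abs]
            norm_num
    rw [hsq]
    have : (1 / 2 + |r|) * (32 * (64 * T)⁻¹) ≤ 1 := by
      rw [show (32 : ℝ) * (64 * T)⁻¹ = (2 * T)⁻¹ by field_simp; ring]
      rw [mul_inv_le_iff₀ (by positivity)]
      linarith
    exact le_trans (mul_le_mul_of_nonneg_right hs (by positivity)) this
  -- pointwise on [-T, T]: (4πδ)² |E|² ≤ |c_F|²
  have hpt : ∀ r ∈ Set.Icc (-T) T,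
      (4 * π * δ) ^ 2 * ‖R.E a z r‖ ^ 2 ≤ ‖R.eisCoeff a Ff r‖ ^ 2 := by
    intro r hr
    have hrT : |r| ≤ T := abs_le.mpr ⟨hr.1, hr.2⟩
    rw [hcoef r]
    have h1 := hh r hrT
    have h2 : (2 * π * δ) ^ 2 ≤ ‖selbergTransform (ballKernel δ) r‖ ^ 2 :=
      pow_le_pow_left₀ (by positivity) h1 2
    nlinarith [norm_nonneg (R.E a z r), sq_nonneg ‖R.E a z r‖]
  -- integrate over [-T, T]
  have hcint : Integrable (fun r : ℝ => ‖R.eisCoeff a Ff r‖ ^ 2) := R.integrable_eisCoeff_sq hFt a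
  have hEcont : Continuous fun r : ℝ => ‖R.E a z r‖ ^ 2 := (R.continuous_E a z).norm.pow 2
  have hint1 : ∫ r in (-T)..T, (4 * π * δ) ^ 2 * ‖R.E a z r‖ ^ 2 ≤
      ∫ r in (-T)..T, ‖R.eisCoeff a Ff r‖ ^ 2 :=
    intervalIntegral.integral_mono_on (by linarith) ((hEcont.const_mul _).intervalIntegrable _ _)
      hcint.intervalIntegrable (fun r hr => hpt r hr)
  have hint2 : ∫ r in (-T)..T, ‖R.eisCoeff a Ff r‖ ^ 2 ≤ ∫ r : ℝ, ‖R.eisCoeff a Ff r‖ ^ 2 := by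
    rw [intervalIntegral.integral_of_le (by linarith)]
    exact setIntegral_le_integral hcint (Eventually.of_forall fun r => by positivity)
  rw [intervalIntegral.integral_const_mul] at hint1
  -- combine
  have hN : (orbitCount Γ δ z : ℝ) ≤ orbitCount Γ (1 / 4096) z := by
    exact_mod_cast orbitCount_mono hΓ hd hδ.le hδ' z
  have hπ := Real.pi_pos
  have key : (4 * π * δ) ^ 2 * ∫ r in (-T)..T, ‖R.E a z r‖ ^ 2 ≤
      4 * π * (2 * orbitCount Γ δ z * (4 * π * δ)) := by
    have h1 := hint1.trans hint2
    have h2 : ∫ r : ℝ, ‖R.eisCoeff a Ff r‖ ^ 2 ≤ 4 * π * (2 * orbitCount Γ δ z * (4 * π * δ)) := by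
      have := mul_le_mul_of_nonneg_left hBessel (by positivity : (0 : ℝ) ≤ 4 * π)
      rwa [← mul_assoc, show 4 * π * (1 / (4 * π)) = 1 by field_simp, one_mul] at this
    exact h1.trans h2
  have hδT : δ⁻¹ = 4096 * T ^ 2 := by rw [hδdef, inv_inv]; ring
  have key2 : ∫ r in (-T)..T, ‖R.E a z r‖ ^ 2 ≤ 2 * orbitCount Γ δ z * δ⁻¹ := by
    rw [← sub_nonneg]
    have e : 2 * (orbitCount Γ δ z : ℝ) * δ⁻¹ - ∫ r in (-T)..T, ‖R.E a z r‖ ^ 2 =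
        ((4 * π) ^ 2 * δ ^ 2)⁻¹ * (4 * π * (2 * orbitCount Γ δ z * (4 * π * δ)) -
          (4 * π * δ) ^ 2 * ∫ r in (-T)..T, ‖R.E a z r‖ ^ 2) := by
      field_simp
    rw [e]
    exact mul_nonneg (by positivity) (by linarith)
  calc ∫ r in (-T)..T, ‖R.E a z r‖ ^ 2 ≤ 2 * orbitCount Γ δ z * δ⁻¹ := key2
    _ = 8192 * orbitCount Γ δ z * T ^ 2 := by rw [hδT]; ring
    _ ≤ 8192 * orbitCount Γ (1 / 4096) z * T ^ 2 := by gcongr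

end SpectralResolution

end LocalWeyl

/-! ## 5. Theorem 7.4 (7.17) from the resolution -/

section ApproximateIdentityComplex

variable {k : ℝ → ℝ}

/-- **`|h(iθ)| ≤ 4π ∫₀^∞ k` for `|θ| ≤ 1/2` and `k ≥ 0`**: `h(iθ) = ∫ cosh(θr) g(r) dr ≤ ∫ cosh(r/2) g = h(i/2)`
(the transforms at the spectral parameters of the eigenvalues `0 ≤ λ < 1/4`). [folklore] -/
theorem norm_selbergTransform_I_mul_le_of_nonneg (hk : IsTestKernel k) (h0 : ∀ u, 0 ≤ k u) {θ : ℝ}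
    (hθ : |θ| ≤ 1 / 2) : ‖selbergTransform k (Complex.I * θ)‖ ≤ 4 * π * ∫ u in Ioi 0, k u := by
  obtain ⟨hkm, ⟨B, hB⟩, ⟨M, hM0, hM⟩⟩ := id hk
  have hg0 : ∀ r, 0 ≤ selbergG k r := selbergG_nonneg h0
  rw [mul_comm, selbergTransform_mul_I_eq hkm hB hM hM0 θ, Complex.norm_real,
    four_pi_integral_eq_integral_cosh_selbergG hk,
    Real.norm_of_nonneg (integral_nonneg fun r => mul_nonneg (Real.cosh_pos _).le (hg0 r))]
  refine integral_mono (integrable_mul_selbergG hkm hB hM hM0 (by fun_prop))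
    (integrable_mul_selbergG hkm hB hM hM0 (by fun_prop)) fun r => ?_
  refine mul_le_mul_of_nonneg_right (Real.cosh_le_cosh.mpr ?_) (hg0 r)
  rw [abs_mul, abs_mul, abs_of_pos (by norm_num : (0 : ℝ) < 1 / 2)]
  exact mul_le_mul_of_nonneg_right hθ (abs_nonneg r)

/-- `|h_n(iθ)| ≤ 1` for the approximate identity `k_n` and `|θ| ≤ 1/2`. [folklore] -/
theorem norm_selbergTransform_bump_I_mul_le (n : ℕ) {θ : ℝ} (hθ : |θ| ≤ 1 / 2) :
    ‖selbergTransform (bump n) (Complex.I * θ)‖ ≤ 1 := by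
  have h := norm_selbergTransform_I_mul_le_of_nonneg (isTestKernel_bump n) (bump_nonneg n) hθ
  rwa [integral_bump] at h

/-- `|h_n(t(λ))| ≤ 1` for every eigenvalue `λ ≥ 0`. [folklore] -/
theorem norm_selbergTransform_bump_specT_le (n : ℕ) {l : ℝ} (hl : 0 ≤ l) :
    ‖selbergTransform (bump n) (specT l)‖ ≤ 1 := by
  by_cases h : 1 / 4 ≤ l
  · rw [specT_of_le h]; exact norm_selbergTransform_bump_le n _
  · rw [specT_of_lt (not_le.mp h)]
    refine norm_selbergTransform_bump_I_mul_le n ?_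
    rw [abs_of_nonneg (Real.sqrt_nonneg _)]
    exact sqrt_quarter_sub_le hl

/-- **`h_n(t) → 1` for every COMPLEX `t`** (`h_n(t) - h_n(i/2) = ∫ (e^{irt} - e^{-r/2}) g_n(r) dr`, the
support of `g_n` shrinks to `{0}` and `∫ g_n ≤ 1`; `tendsto_selbergTransform_bump` is the real case).
[folklore] -/
theorem tendsto_selbergTransform_bump_complex (t : ℂ) :
    Tendsto (fun n : ℕ => selbergTransform (bump n) t) atTop (𝓝 1) := by
  rw [Metric.tendsto_atTop]
  intro ε hε
  set ψ : ℝ → ℂ := fun r => Complex.exp (Complex.I * r * t) - Complex.exp (Complex.I * r * (Complex.I / 2)) with hψ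
  have hψc : Continuous ψ := by simp only [hψ]; fun_prop
  have hψ0 : ψ 0 = 0 := by simp [hψ]
  obtain ⟨η, hη, hηε⟩ : ∃ η > 0, ∀ r : ℝ, |r| < η → ‖ψ r‖ < ε / 2 := by
    obtain ⟨η, hη, h⟩ := Metric.continuousAt_iff.mp (hψc.continuousAt (x := 0)) (ε / 2) (by positivity)
    refine ⟨η, hη, fun r hr => ?_⟩
    have := @h r (by simpa [Real.dist_eq] using hr)
    rwa [hψ0, dist_zero_right] at this
  obtain ⟨N, hN⟩ := (Metric.tendsto_atTop.mp tendsto_supportRadius) η hη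
  refine ⟨N, fun n hn => ?_⟩
  have hkn := isTestKernel_bump n
  obtain ⟨hm, ⟨B, hB⟩, _⟩ := id hkn
  have hM : ∀ u, 1 / ((n : ℝ) + 1) ≤ u → bump n u = 0 := fun u hu => bump_eq_zero hu
  have hM0 : (0 : ℝ) ≤ 1 / ((n : ℝ) + 1) := by positivity
  have hρ : 2 * Real.arsinh (Real.sqrt (1 / ((n : ℝ) + 1))) < η := by
    have := hN n hn
    rw [Real.dist_eq, sub_zero, abs_of_nonneg] at this
    · exact this
    · have : 0 ≤ Real.arsinh (Real.sqrt (1 / ((n : ℝ) + 1))) := Real.arsinh_nonneg_iff.mpr (Real.sqrt_nonneg _)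
      linarith
  have hdiff : selbergTransform (bump n) t - 1 = ∫ r : ℝ, ψ r * (selbergG (bump n) r : ℂ) := by
    rw [← selbergTransform_bump_I_half n]
    unfold selbergTransform
    rw [← integral_sub (integrable_mul_selbergG_complex hm hB hM hM0 (by fun_prop))
      (integrable_mul_selbergG_complex hm hB hM hM0 (by fun_prop))]
    congr 1 with r
    simp only [hψ]
    ring
  have hg0 : ∀ r, 0 ≤ selbergG (bump n) r := selbergG_nonneg (bump_nonneg n)
  have hpt : ∀ r : ℝ, ‖ψ r * (selbergG (bump n) r : ℂ)‖ ≤ ε / 2 * selbergG (bump n) r := by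
    intro r
    rw [norm_mul, Complex.norm_real, Real.norm_of_nonneg (hg0 r)]
    by_cases hr : |r| < η
    · exact mul_le_mul_of_nonneg_right (hηε r hr).le (hg0 r)
    · rw [selbergG_eq_zero hM hM0 (le_trans hρ.le (not_lt.mp hr))]
      simp
  rw [dist_eq_norm, hdiff]
  calc ‖∫ r : ℝ, ψ r * (selbergG (bump n) r : ℂ)‖
      ≤ ∫ r : ℝ, ε / 2 * selbergG (bump n) r :=
        norm_integral_le_of_norm_le ((integrable_selbergG hkn).const_mul _) (Eventually.of_forall hpt)
    _ = ε / 2 * ∫ r : ℝ, selbergG (bump n) r := integral_const_mul _ _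
    _ ≤ ε / 2 * 1 := by
        gcongr
        have := integral_selbergG_le hkn (bump_nonneg n)
        rwa [integral_bump] at this
    _ < ε := by linarith

end ApproximateIdentityComplex

section Expansion

variable {Γ : Subgroup (GL (Fin 2) ℝ)} {F : Set ℍ} {k : ℝ → ℝ}
variable (hΓ : Γ ≤ (Matrix.SpecialLinearGroup.toGL : SL(2, ℝ) →* GL (Fin 2) ℝ).range)
  (hneg : (-1 : GL (Fin 2) ℝ) ∈ Γ) (hd : IsDiscreteSubgroup Γ) (hF : IsHypFundamentalDomain Γ F)
  (hvol : volume F < ⊤)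
include hΓ hneg hd hF hvol

namespace SpectralResolution

variable (R : SpectralResolution Γ F)

omit hvol in
/-- **Absolute convergence of the spectral side of (7.17)** for an admissible transform `h` ((1.63)):
`Σ_j |h(t_j) u_j(z) ū_j(w)| < ∞` over the whole discrete family and
`∫ |h(r) E_𝔞(z, r) Ē_𝔞(w, r)| dr < ∞` — the finitely many `λ_j < 1/4` aside, by (7.10) at `z` and `w`,
Cauchy's inequality and partial summation (`ModularPretrace`), the majorant coming from (1.63).
[cite: Iwaniec2002, Thm 7.4 & (12.5), PDF pp. 76, 125] -/
theorem summable_and_integrable_spectral (hk : IsTestKernel k) (hka : IsAdmissibleTransform (selbergTransform k))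
    (z w : ℍ) :
    Summable (fun j : R.ι => ‖selbergTransform k (specT (R.lam j)) * R.u j z * conj (R.u j w)‖) ∧
      ∀ a, Integrable (fun r : ℝ => selbergTransform k r * R.E a z r * conj (R.E a w r)) := by
  obtain ⟨H, hH, hH0, hHi, hhH⟩ := exists_majorant_of_admissible hka
  constructor
  · -- the large eigenvalues: partial summation with (7.10)
    set s : Finset R.ι := R.finite_small.toFinset with hs
    have hlarge : ∀ j : {x // x ∉ s}, 1 / 4 ≤ R.lam j := fun j => by
      have h : (j : R.ι) ∉ s := j.2
      have h' : ¬ R.lam j < 1 / 4 := fun hlt => h (by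
        show (j : R.ι) ∈ R.finite_small.toFinset
        exact (Set.Finite.mem_toFinset _).mpr hlt)
      exact not_lt.mp h'
    have hsub := (Pretrace.tsum_spectral_le (J := {x // x ∉ s}) (fun j => R.tR j) (fun j => R.u j z) (fun j => R.u j w)
      (fun r => selbergTransform k r)
      (fun T hT S hS => by
        classical
        have h := R.localWeyl_discrete hΓ hneg hd hF z hT (S.map (Function.Embedding.subtype _))
          (fun j hj => by
            obtain ⟨j', hj', rfl⟩ := Finset.mem_map.mp hj
            exact ⟨hlarge j', hS j' hj'⟩)
        rwa [Finset.sum_map] at h)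
      (fun T hT S hS => by
        classical
        have h := R.localWeyl_discrete hΓ hneg hd hF w hT (S.map (Function.Embedding.subtype _))
          (fun j hj => by
            obtain ⟨j', hj', rfl⟩ := Finset.mem_map.mp hj
            exact ⟨hlarge j', hS j' hj'⟩)
        rwa [Finset.sum_map] at h)
      hH hH0 hHi hhH).1
    refine (Finset.summable_compl_iff s).mp ?_
    refine hsub.congr fun j => ?_
    rw [R.specT_eq_tR (hlarge j)]
  · intro a
    obtain ⟨Az, hAz⟩ := R.localWeyl_eisenstein hΓ hneg hd hF z
    obtain ⟨Aw, hAw⟩ := R.localWeyl_eisenstein hΓ hneg hd hF w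
    have hhc : Continuous fun r : ℝ => selbergTransform k r :=
      (differentiable_selbergTransform hk).continuous.comp Complex.continuous_ofReal
    exact (Pretrace.integral_spectral_le (fun r => R.E a z r) (fun r => R.E a w r) (R.continuous_E a z)
      (R.continuous_E a w) (fun r => selbergTransform k r) hhc (fun T hT => hAz T hT a) (fun T hT => hAw T hT a)
      hH hH0 hHi hhH).1

/-- **The Parseval identity for a pair of automorphic kernels** (`K₁(·, z)` and `K₂(·, w)`, continuous
test kernels): `2 L_{k₁}(K₂(·, w))(z) = Σ_j 4h₁(t_j)h₂(t_j) u_j(z) ū_j(w) + (1/4π) Σ_𝔞 ∫ 4h₁(r)h₂(r) E_𝔞(z,r) Ē_𝔞(w,r) dr`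
— (7.17) for the composed point-pair invariant `k₁ ∗ k₂`. The left side is `∫_F K₁(z,v) K₂(v,w) dμ(v)`
unfolded; the coefficients are those of §3. [cite: Iwaniec2002, Thm 7.3 (7.15) & §7.4, PDF pp. 75–76] -/
theorem parseval_kernels {k₁ k₂ : ℝ → ℝ} (hk₁ : IsTestKernel k₁) (hk₁c : Continuous k₁) (hk₂ : IsTestKernel k₂)
    (hk₂c : Continuous k₂) (z w : ℍ) :
    2 * invariantOperator k₁ (fun v => (automorphicKernel Γ k₂ v w : ℂ)) z =
      (∑' j, 4 * selbergTransform k₁ (specT (R.lam j)) * selbergTransform k₂ (specT (R.lam j)) *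
          R.u j z * conj (R.u j w)) +
        1 / (4 * π) * ∑ a, ∫ r : ℝ, 4 * selbergTransform k₁ r * selbergTransform k₂ r *
          R.E a z r * conj (R.E a w r) := by
  obtain ⟨_, _, ⟨M₁, _, hM₁⟩⟩ := id hk₁
  set F₁ : ℍ → ℂ := fun v => (automorphicKernel Γ k₁ v z : ℂ) with hF₁def
  set G : ℍ → ℂ := fun v => (automorphicKernel Γ k₂ v w : ℂ) with hGdef
  have hF₁ : IsFdTestOn Γ F F₁ := isFdTestOn_automorphicKernel hΓ hd hk₁ hk₁c z
  have hG : IsFdTestOn Γ F G := isFdTestOn_automorphicKernel hΓ hd hk₂ hk₂c w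
  have hP := R.parseval_polar hvol hF.measurableSet hF₁ hG
  -- the left-hand side, unfolded
  have hGc : Continuous G := Complex.continuous_ofReal.comp (continuous_automorphicKernel_left hΓ hd hk₂ hk₂c w)
  have hL : (∫ v in F, conj (F₁ v) * G v) = 2 * invariantOperator k₁ G z := by
    rw [← setIntegral_automorphicKernel_mul hΓ hneg hd hF hk₁ (automorphicKernel_isAutomorphic hΓ hd hk₂ w)
      hGc.locallyIntegrable z]
    refine setIntegral_congr_fun hF.measurableSet fun v _ => ?_
    simp only [hF₁def]
    rw [Complex.conj_ofReal, automorphicKernel_comm hΓ hd hM₁ v z]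
  -- the discrete terms
  have hdisc : ∀ j, conj (R.coeff j F₁) * R.coeff j G =
      4 * selbergTransform k₁ (specT (R.lam j)) * selbergTransform k₂ (specT (R.lam j)) * R.u j z * conj (R.u j w) := by
    intro j
    rw [hF₁def, hGdef, R.coeff_automorphicKernel hΓ hneg hd hF hk₁ j z, R.coeff_automorphicKernel hΓ hneg hd hF hk₂ j w,
      map_mul, map_mul, Complex.conj_conj, conj_selbergTransform_specT, conj_ofNat_two]
    ring
  -- the Eisenstein terms
  have heis : ∀ a, (fun r : ℝ => conj (R.eisCoeff a F₁ r) * R.eisCoeff a G r) = fun r : ℝ =>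
      4 * selbergTransform k₁ r * selbergTransform k₂ r * R.E a z r * conj (R.E a w r) := by
    intro a
    funext r
    rw [hF₁def, hGdef, R.eisCoeff_automorphicKernel hΓ hneg hd hF hk₁ a z r,
      R.eisCoeff_automorphicKernel hΓ hneg hd hF hk₂ a w r, map_mul, map_mul, Complex.conj_conj,
      conj_selbergTransform_ofReal, conj_ofNat_two]
    ring
  rw [hL] at hP
  rw [hP, tsum_congr hdisc]
  congr 2
  exact Finset.sum_congr rfl fun a _ => by rw [heis a]

/-- **Theorem 7.4 (7.17) for a general finite volume group from its spectral resolution.** For a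
continuous compactly supported point-pair invariant `k` whose transform `h` satisfies (1.63), and
all `z, w ∈ ℍ`:
`Σ_{γ ∈ Γ} k(u(γz, w)) = 2 [ Σ_j h(t_j) u_j(z) ū_j(w) + (1/4π) Σ_𝔞 ∫ h(r) E_𝔞(z, r) Ē_𝔞(w, r) dr ]`
(matrix normalisation: the factor `2` counts `±γ`), the series and the integrals converging
absolutely; `t_j = t(λ_j)` (`√(λ_j - 1/4)` or `i√(1/4 - λ_j)`). Proof: the pair identity
`parseval_kernels` with `k₁ = k_n` an approximate identity (`h_n → 1` boundedly on `ℝ ∪ i[-1/2, 1/2]`,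
`L_{k_n}K(·, w)(z) → K(z, w)`) and dominated convergence on the spectral side, justified by (7.10).
(The book argues through the pointwise form (7.16) on `𝓓(Γ\ℍ)` and "a suitable approximation", p. 76.)
[cite: Iwaniec2002, Thm 7.4 (7.17), PDF p. 76] -/
theorem automorphicKernel_eq_spectralExpansion (hk : IsTestKernel k) (hkc : Continuous k)
    (hka : IsAdmissibleTransform (selbergTransform k)) (z w : ℍ) :
    Summable (fun j : R.ι => ‖selbergTransform k (specT (R.lam j)) * R.u j z * conj (R.u j w)‖) ∧
      (∀ a, Integrable (fun r : ℝ => selbergTransform k r * R.E a z r * conj (R.E a w r))) ∧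
      (automorphicKernel Γ k z w : ℂ) =
        2 * ((∑' j, selbergTransform k (specT (R.lam j)) * R.u j z * conj (R.u j w)) +
          ((1 / (4 * π) : ℝ) : ℂ) * ∑ a, ∫ r : ℝ, selbergTransform k r * R.E a z r * conj (R.E a w r)) := by
  obtain ⟨hsum, hint⟩ := R.summable_and_integrable_spectral hΓ hneg hd hF hk hka z w
  refine ⟨hsum, hint, ?_⟩
  -- notation
  set h : ℂ → ℂ := selbergTransform k with hh
  set T : R.ι → ℂ := fun j => specT (R.lam j) with hT
  set E : Fin R.c → ℍ → ℝ → ℂ := R.E with hE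
  set G : ℍ → ℂ := fun v => (automorphicKernel Γ k v w : ℂ) with hGdef
  have hGc : Continuous G := Complex.continuous_ofReal.comp (continuous_automorphicKernel_left hΓ hd hk hkc w)
  -- the identities at level `n`
  have hn : ∀ n : ℕ, 2 * invariantOperator (bump n) G z =
      (∑' j, 4 * selbergTransform (bump n) (T j) * h (T j) * R.u j z * conj (R.u j w)) +
      1 / (4 * π) * ∑ a, ∫ r : ℝ, 4 * selbergTransform (bump n) r * h r * E a z r * conj (E a w r) :=
    fun n => R.parseval_kernels hΓ hneg hd hF hvol (isTestKernel_bump n) (continuous_bump n) hk hkc z w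
  -- the limit of the left-hand side
  have hlhs : Tendsto (fun n : ℕ => 2 * invariantOperator (bump n) G z) atTop (𝓝 (2 * G z)) :=
    (tendsto_invariantOperator_bump hGc z).const_mul 2
  -- uniform bound `|h_n(T_j)| ≤ 1`
  have hbnd : ∀ n j, ‖selbergTransform (bump n) (T j)‖ ≤ 1 := fun n j =>
    norm_selbergTransform_bump_specT_le n (R.lam_nonneg hΓ hneg hd hF j)
  -- the limit of the discrete series (dominated convergence)
  have hdisc : Tendsto (fun n : ℕ => ∑' j, 4 * selbergTransform (bump n) (T j) * h (T j) * R.u j z * conj (R.u j w))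
      atTop (𝓝 (∑' j, 4 * h (T j) * R.u j z * conj (R.u j w))) := by
    refine tendsto_tsum_of_dominated_convergence (bound := fun j => 4 * ‖h (T j) * R.u j z * conj (R.u j w)‖)
      (hsum.mul_left 4) (fun j => ?_) (Eventually.of_forall fun n j => ?_)
    · have e : (fun n : ℕ => 4 * selbergTransform (bump n) (T j) * h (T j) * R.u j z * conj (R.u j w)) =
          fun n : ℕ => 4 * selbergTransform (bump n) (T j) * (h (T j) * R.u j z * conj (R.u j w)) := by
        funext n; ring
      rw [e, show 4 * h (T j) * R.u j z * conj (R.u j w) = 4 * 1 * (h (T j) * R.u j z * conj (R.u j w)) by ring]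
      exact ((tendsto_selbergTransform_bump_complex (T j)).const_mul 4).mul_const _
    · rw [show 4 * selbergTransform (bump n) (T j) * h (T j) * R.u j z * conj (R.u j w) =
          (4 * selbergTransform (bump n) (T j)) * (h (T j) * R.u j z * conj (R.u j w)) by ring, norm_mul, norm_mul]
      have h4 : ‖(4 : ℂ)‖ = 4 := by simp
      rw [h4]
      have := hbnd n j
      have h0 : 0 ≤ ‖h (T j) * R.u j z * conj (R.u j w)‖ := norm_nonneg _
      nlinarith
  -- the limit of the Eisenstein integrals (dominated convergence)
  have heis : ∀ a, Tendsto (fun n : ℕ => ∫ r : ℝ, 4 * selbergTransform (bump n) r * h r * E a z r * conj (E a w r))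
      atTop (𝓝 (∫ r : ℝ, 4 * h r * E a z r * conj (E a w r))) := by
    intro a
    refine tendsto_integral_of_dominated_convergence (fun r => 4 * ‖h r * E a z r * conj (E a w r)‖)
      (fun n => ?_) (((hint a).norm).const_mul 4) (fun n => ?_) ?_
    · refine Continuous.aestronglyMeasurable ?_
      have hc1 : Continuous fun r : ℝ => selbergTransform (bump n) r :=
        (differentiable_selbergTransform (isTestKernel_bump n)).continuous.comp Complex.continuous_ofReal
      have hc2 : Continuous fun r : ℝ => h r :=
        (differentiable_selbergTransform hk).continuous.comp Complex.continuous_ofReal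
      exact (((continuous_const.mul hc1).mul hc2).mul (R.continuous_E a z)).mul
        (Complex.continuous_conj.comp (R.continuous_E a w))
    · refine Eventually.of_forall fun r => ?_
      rw [show 4 * selbergTransform (bump n) r * h r * E a z r * conj (E a w r) =
          (4 * selbergTransform (bump n) r) * (h r * E a z r * conj (E a w r)) by ring, norm_mul, norm_mul]
      have h4 : ‖(4 : ℂ)‖ = 4 := by simp
      rw [h4]
      have := norm_selbergTransform_bump_le n r
      have h0 : 0 ≤ ‖h r * E a z r * conj (E a w r)‖ := norm_nonneg _
      nlinarith
    · refine Eventually.of_forall fun r => ?_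
      have e : (fun n : ℕ => 4 * selbergTransform (bump n) r * h r * E a z r * conj (E a w r)) =
          fun n : ℕ => 4 * selbergTransform (bump n) r * (h r * E a z r * conj (E a w r)) := by
        funext n; ring
      rw [e, show 4 * h r * E a z r * conj (E a w r) = 4 * 1 * (h r * E a z r * conj (E a w r)) by ring]
      exact ((tendsto_selbergTransform_bump r).const_mul 4).mul_const _
  have heis' : Tendsto (fun n : ℕ => ∑ a, ∫ r : ℝ, 4 * selbergTransform (bump n) r * h r * E a z r * conj (E a w r))
      atTop (𝓝 (∑ a, ∫ r : ℝ, 4 * h r * E a z r * conj (E a w r))) :=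
    tendsto_finsetSum _ fun a _ => heis a
  -- pass to the limit in the identities
  have hrhs := hdisc.add (heis'.const_mul (1 / (4 * π) : ℂ))
  have heq : (fun n : ℕ => 2 * invariantOperator (bump n) G z) = fun n : ℕ =>
      (∑' j, 4 * selbergTransform (bump n) (T j) * h (T j) * R.u j z * conj (R.u j w)) +
      1 / (4 * π) * ∑ a, ∫ r : ℝ, 4 * selbergTransform (bump n) r * h r * E a z r * conj (E a w r) := funext hn
  rw [heq] at hlhs
  have hlim := tendsto_nhds_unique hlhs hrhs
  have hGz : G z = (automorphicKernel Γ k z w : ℂ) := rfl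
  rw [← hGz]
  have h2 : G z = ((∑' j, 4 * h (T j) * R.u j z * conj (R.u j w)) +
      1 / (4 * π) * ∑ a, ∫ r : ℝ, 4 * h r * E a z r * conj (E a w r)) / 2 := by
    rw [← hlim]; ring
  rw [h2, show (fun j => 4 * h (T j) * R.u j z * conj (R.u j w)) = fun j => 4 * (h (T j) * R.u j z * conj (R.u j w)) by
    funext j; ring, tsum_mul_left]
  have e3 : ∀ a, ∫ r : ℝ, 4 * h r * E a z r * conj (E a w r) = 4 * ∫ r : ℝ, h r * E a z r * conj (E a w r) := by
    intro a
    rw [← integral_const_mul]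
    congr 1 with r
    ring
  rw [Finset.sum_congr rfl fun a _ => e3 a, ← Finset.mul_sum]
  push_cast
  ring

end SpectralResolution

end Expansion

end Literature.NumberTheory.Automorphic
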